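import Mathlib.GroupTheory.Index
import Mathlib.GroupTheory.QuotientGroup.Basic
import Summits.Ventures.QEC.Census.TwoBlockCyclicKernelTools
import Summits.Ventures.QEC.Census.TwoBlockOrderTwoKernel
import HarnessLib

/-!
# Abelian two-block codes: a subgroup indicator in `ker A ∩ ker B` forces `k ≥ 2 [G : H]`

Setting as in the cell's X-2 files (`Census/TwoBlockCyclicKernel*.lean`, `Census/BB/TwoBlockKernelWeightCounterexample*.lean`):
a finite abelian group `G`, `a, b ∈ 𝔽₂[G]`, the two-block CSS code `css a b`, and a subgroup `H ≤ G` whose indicator `1_H`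
satisfies `A·1_H = 0 = B·1_H` (every coset of `H` meets the supports of `a` and `b` in an even number of points; equivalently
`a, b` lie in the augmentation ideal `I_H`).

* `conv_indH_mem_kerInter` — then EVERY `1_H ⋆ x` (a function constant on the cosets of `H`) lies in `ker A ∩ ker B`;
* `cosetIndicator_linearIndependent` — the `[G : H]` coset indicators are linearly independent and each is `1_H ⋆ δ_g`;
* `index_le_finrank_kerInter`, **`two_mul_index_le_css_k`** — hence `dim (ker A ∩ ker B) ≥ [G : H]` and, by BCGMRY24 Lemma 1
  (`AbelianTwoBlock.css_k_eq`: `k = 2 · dim (ker A ∩ ker B)`), **`k(css a b) ≥ 2 [G : H]`**.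

So the dense `ℤ₂ × ℤ₂`-generator family of the counterexample files (`(a, b)` generating `I_H` exactly, `H ≅ ℤ₂ × ℤ₂`) has rate
`≥ 1/4` — `[[48,12,6]]`, `[[72,18,6]]`, `[[80,20,8]]`, … attain `k = 2[G:H] = n/4` — while `d(ker A ∩ ker B) = 4` stays fixed;
together with the distance theorems this is the structural content of the cell's X-2 dichotomy.  HONEST FRAMING: elementary linear
algebra of ours (no printed statement formalized or contradicted); all proved, axioms standard, 0 kit.
-/

namespace Summit.Ventures.QEC.TwoBlockCyclicKernel

open Matrix Literature.InformationTheory.QuantumCodes Literature.InformationTheory.QuantumCodes.AbelianTwoBlock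

variable {G : Type*} [AddCommGroup G] [Fintype G] [DecidableEq G]

omit [DecidableEq G] in
/-- If `A·1_H = 0` then `A·(1_H ⋆ x) = 0` for every `x`: the coset-constant functions lie in `ker A`. -/
theorem circulant_mulVec_conv_indH_eq_zero (H : AddSubgroup G) [DecidablePred (· ∈ H)] {a : G → ZMod 2}
    (ha : circulant a *ᵥ indH H = 0) (x : G → ZMod 2) : circulant a *ᵥ (circulant (indH H) *ᵥ x) = 0 := by
  rw [conv_assoc, ha, Matrix.circulant_zero, Matrix.zero_mulVec]

omit [DecidableEq G] in
/-- `1_H ⋆ x ∈ ker A ∩ ker B` whenever `A·1_H = B·1_H = 0`. -/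
theorem conv_indH_mem_kerInter (H : AddSubgroup G) [DecidablePred (· ∈ H)] {a b : G → ZMod 2}
    (ha : circulant a *ᵥ indH H = 0) (hb : circulant b *ᵥ indH H = 0) (x : G → ZMod 2) :
    circulant (indH H) *ᵥ x ∈
      LinearMap.ker (circulant a).mulVecLin ⊓ LinearMap.ker (circulant b).mulVecLin := by
  refine Submodule.mem_inf.mpr ⟨LinearMap.mem_ker.mpr ?_, LinearMap.mem_ker.mpr ?_⟩
  · rw [Matrix.mulVecLin_apply]; exact circulant_mulVec_conv_indH_eq_zero H ha x
  · rw [Matrix.mulVecLin_apply]; exact circulant_mulVec_conv_indH_eq_zero H hb x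

open Classical in
/-- The indicator of the coset `q ∈ G/H`, as a function on `G` (classical `if`). (definition) -/
noncomputable def cosetIndicator (H : AddSubgroup G) (q : G ⧸ H) : G → ZMod 2 :=
  fun u => if (QuotientAddGroup.mk u : G ⧸ H) = q then 1 else 0

/-- `1_H ⋆ δ_g` is the indicator of the coset `g + H`. -/
theorem conv_indH_single (H : AddSubgroup G) [DecidablePred (· ∈ H)] (g : G) :
    circulant (indH H) *ᵥ Pi.single g (1 : ZMod 2) = cosetIndicator H (QuotientAddGroup.mk g) := by
  funext u
  rw [Summit.Ventures.QEC.TwoBlockOrderTwo.conv_single_apply, indH, cosetIndicator]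
  have : (u - g ∈ H) ↔ ((QuotientAddGroup.mk u : G ⧸ H) = QuotientAddGroup.mk g) := by
    rw [QuotientAddGroup.eq, ← H.neg_mem_iff, neg_sub, sub_eq_neg_add]
  by_cases h : u - g ∈ H
  · rw [if_pos h, if_pos (this.mp h)]
  · rw [if_neg h, if_neg (fun h' => h (this.mpr h'))]

omit [Fintype G] [DecidableEq G] in
/-- The coset indicators are linearly independent (disjoint supports, each non-zero). -/
theorem cosetIndicator_linearIndependent (H : AddSubgroup G) :
    LinearIndependent (ZMod 2) (cosetIndicator H) := by
  classical
  rw [linearIndependent_iff']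
  intro s c hsum q hq
  obtain ⟨g, rfl⟩ := QuotientAddGroup.mk_surjective q
  have h := congr_fun hsum g
  simp only [Finset.sum_apply, Pi.smul_apply, smul_eq_mul, Pi.zero_apply, cosetIndicator] at h
  rw [Finset.sum_eq_single (QuotientAddGroup.mk g : G ⧸ H)] at h
  · simpa using h
  · intro q' _ hne
    rw [if_neg (Ne.symm hne), mul_zero]
  · intro hnot; exact absurd hq hnot

/-- **`dim (ker A ∩ ker B) ≥ [G : H]`** when `A·1_H = B·1_H = 0`. -/
theorem index_le_finrank_kerInter (H : AddSubgroup G) [DecidablePred (· ∈ H)] {a b : G → ZMod 2}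
    (ha : circulant a *ᵥ indH H = 0) (hb : circulant b *ᵥ indH H = 0) :
    H.index ≤ Module.finrank (ZMod 2)
      ↥(LinearMap.ker (circulant a).mulVecLin ⊓ LinearMap.ker (circulant b).mulVecLin) := by
  classical
  set K := LinearMap.ker (circulant a).mulVecLin ⊓ LinearMap.ker (circulant b).mulVecLin with hK
  -- the coset indicators, as elements of K
  have hmem : ∀ q : G ⧸ H, cosetIndicator H q ∈ K := by
    intro q
    obtain ⟨g, rfl⟩ := QuotientAddGroup.mk_surjective q
    rw [← conv_indH_single]
    exact conv_indH_mem_kerInter H ha hb _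
  let f : G ⧸ H → K := fun q => ⟨cosetIndicator H q, hmem q⟩
  have hf : LinearIndependent (ZMod 2) f := by
    apply LinearIndependent.of_comp K.subtype
    exact cosetIndicator_linearIndependent H
  haveI : Fintype (G ⧸ H) := Fintype.ofFinite _
  have h := hf.fintype_card_le_finrank
  rwa [AddSubgroup.index, Nat.card_eq_fintype_card]

/-- **`k(css a b) ≥ 2 [G : H]`** whenever the indicator of a subgroup `H` lies in `ker A ∩ ker B`
(`k = 2 · dim (ker A ∩ ker B)`, BCGMRY24 Lemma 1 / `AbelianTwoBlock.css_k_eq`). -/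
theorem two_mul_index_le_css_k (H : AddSubgroup G) [DecidablePred (· ∈ H)] {a b : G → ZMod 2}
    (ha : circulant a *ᵥ indH H = 0) (hb : circulant b *ᵥ indH H = 0) :
    2 * H.index ≤ (css a b).k := by
  rw [css_k_eq]
  exact Nat.mul_le_mul_left 2 (index_le_finrank_kerInter H ha hb)

end Summit.Ventures.QEC.TwoBlockCyclicKernel
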